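import Literature.MathematicalPhysics.QuantumFieldTheory.Balaban1983to89.B11Eq115Space
import Literature.MathematicalPhysics.QuantumFieldTheory.Balaban1983to89.T3ContinuumYM3Torus
import HarnessLib

/-!
# Route `UnitScaleTilt`, crux K1 child «MinimiserStabilityRegPr» (stmt-QuantumFields-19200), leaf V2′ `stub_halvingStep` — PILLAR F4
# (OWNER RULING g20-№8 §A3): **[Balaban1985Variational] PROPOSITION 6 FOR EQ. (158) OF SECT. F («`A₁ + G̃((δ/δA′)V)(A₁ + HB) = 0`»,
# background `1`) TYPED AND PROVED AT THE d = 3 CARRIER** — the flat small-solution theorem in the CONCRETE sup norms (115)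
# `max{sup_b |A(b)|, L^{K−n}·sup_{b,ν} |A(b + e_ν) − A(b)|}` on bond fields of the fine torus `PBond (F.P K) 0`, over ABSTRACT flat-operator
# data: `G̃` any ℂ-linear operator with the printed sup → (115) bound `B₀` ([Balaban1984PropagatorsII] (2.47)–(2.51) shape; pillar F3
# `…Prop8FlatPropagatorSup/Prop12/Grad` discharges it), `𝔄 = HB` any field of (115)-size `< a` (pillar F3 `…Prop8FlatMinimizerH` + (160)),
# `W = (δ/δA′)V` any map with PROPOSITION 4's (98) `|W(A′)|₍₋₃₎ ≤ C₄‖A′‖²₍₁₁₅₎` on the (115)-ball of radius `a₃` and holomorphic there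

Cell `ym3-torus` (HUMAN RULING D-0037, YM ladder rung R3), seat `ym-ust-19200-f4` gen 0 (one-shot pen minted by OWNER RULING g20-№8 §A3).
`--supports stmt-QuantumFields-19200 --as helper`; count-neutral; bears_on R3:stmt-QuantumFields-19200:stub_halvingStep (v7 cc37a17877262141;
the v8 re-cut names this pillar `stub_flatSmallSolution158`).

THE PRINT ([Balaban1985Variational] = T. Bałaban, CMP **102** (1985) 277–309; journal page = PDF page + 276).  p. 294 (115): *«Let us consider
this equation for configurations A₁ in the space |A₁| < ε₄(L^jη)⁻¹, |∇A₁| < ε₄(L^jη)⁻² on Ω_j, i.e. max{|A₁|₍₋₁₎, |∇A₁|₍₋₂₎} < ε₄.»*;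
p. 295 Prop. 6: *«There exists a positive, absolute constant a₄ such, that for ε₄ ≤ a₄ … Eq. (111) has exactly one solution in the space
(115). … Moreover, if we replace the configuration H₁B by an arbitrary configuration 𝔄 … then the above statement is again true»*; p. 300
(143): *«This equation has all the properties of Eq. (111) and Proposition 6 is valid for it also»*; p. 302 (158): *«The image of U′_k is a
minimum of 𝔊(A′), thus representing it as A₁ + HB, we obtain Eq. (143) for A₁. In the considered case it can be written as
A₁ + G̃((δ/δA′)V)(A₁ + HB) = 0. (158) The configurations HB and A₁ satisfy (152) with the bounds 4dL²B₁Mε₀ and 40dL²B₁Mε₀ correspondingly.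
… We assume that it belongs to the domain on which this equation has a unique solution, i.e. we assume that 40dL²B₁Mε₀ ≤ a₄. … Let us
notice that all the operators in this section are taken without any external gauge field configuration (or alternatively with the
configuration equal to 1).»*; p. 304 (165): *«This bound, the equality (159) and Eq. (158) imply |A|, |∇A|, … < ¼M_Δ max{B₃ε₁, ½ε₀} +
B₀C₄(36dL²B₁Mε₀)² + B₀4C₂(36dL²B₁Mε₀)²»* — the middle term is `|A₁|₍₁₁₅₎ ≤ B₀C₄‖A₁ + HB‖²₍₁₁₅₎` READ OFF (158) (§3 below).

AT THE CARRIER (`T3Thm1Carrier.varProblem3 F n K`: ONE level, all `Ω_j = T_η`, top scale `j = k = K − n`, `L^kη = 1`, fine spacing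
`η = L^{−(K−n)}`): the sizes of p. 286 collapse to `|A|₍₋₁₎ = sup_b ‖A(b)‖`, `|∇^ηA|₍₋₂₎ = L^{K−n}·sup_{b,ν} ‖A(b₋ + e_ν, μ(b)) − A(b)‖`,
`|f|₍₋₃₎ = sup_b ‖f(b)‖` — exactly the letters of pillar F3 (`FlatMinimizerH.exists_flatH_T3`: `|Hb| ≤ C·β`, `L^{K−n}·|(Hb)(⟨s+e_ν,μ⟩) − (Hb)(⟨s,μ⟩)| ≤
C·β`; `FlatPropagatorSup.abs_GE_le_sup_T3`, `FlatPropagatorGrad.grad_lap_GE_le_of_ineq110`).  Every statement below is in that POINTWISE vocabulary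
(`VecField P 0 V = PBond P 0 → V`, `Site.shift`); the normed spaces are internal to the proofs.

WHAT IS PROVED (sorry-free; no definition; axioms standard).  For EVERY `P : Params` and weight `c > 0` (§2–§4), then at the d = 3 carrier with
`c = L^{K−n}` (§5); fibre `V` = any finite-dimensional complex normed space (print: the complexified Lie algebra 𝔤ᶜ, e.g. `Matrix (Fin 2) (Fin 2) ℂ`):
* §1 `exists_diffLin` — the forward difference `A ↦ ((b, ν) ↦ A(b₋ + e_ν, μ(b)) − A(b))` as a ℂ-linear map (for the jet norm).
* §2 **`existsUnique_smallSolution158`** — PROPOSITION 6 FOR (158): `G : VecField P 0 V →ₗ[ℂ] VecField P 0 V` with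
  `(∀ b, ‖f b‖ ≤ β) → (∀ b, ‖(Gf)(b)‖ ≤ B₀β) ∧ (∀ s μ ν, c·‖(Gf)(⟨s+e_ν,μ⟩) − (Gf)(⟨s,μ⟩)‖ ≤ B₀β)`; `W` with (98) read pointwise
  (`(115)-size of Y ≤ r < a₃ ⇒ ∀ b, ‖(WY)(b)‖ ≤ C₄r²`) and `DifferentiableOn ℂ W` on the open (115)-ball of radius `a₃` (Prop. 4: *«The functional
  derivative of V(A′) is an analytic function on this space»*); `𝔄` with (115)-size `< a`, `a ≤ ε₄`, and Prop. 6's own `a₄` UNFOLDED as in the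
  tree's `B11Prop6Scheme.eq158_solution` (`4ε₄ ≤ a₃`, `16B₀C₄ε₄ ≤ 1`; print «40dL²B₁Mε₀ ≤ a₄») ⟹ there is EXACTLY ONE `A₁` of (115)-size `≤ ε₄`
  with `A₁ + G(W(A₁ + 𝔄)) = 0`.  Mechanism: lit-balaban's `B11Eq115Space.JetSup` (the space (115) as a genuine Banach space over ANY finite
  index) at `ι := PBond P 0` + `B11Prop6Scheme.eq158_solution` ((116)–(121): self-map (118), Cauchy-formula Lipschitz bound (119)–(120),
  Banach) BY NAME — no analysis re-done.
* §3 **`size115_solution158_le`** — THE (165) ENTRY: ANY `A₁` with `A₁ + G(W(A₁ + 𝔄)) = 0` and `‖A₁ + 𝔄‖₍₁₁₅₎ ≤ ρ < a₃` has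
  `‖A₁‖₍₁₁₅₎ ≤ B₀C₄ρ²` pointwise (print: `ρ = 36dL²B₁Mε₀`); needs neither smallness nor uniqueness.
* §4 **`solution158_mem_ker`** — the TRUE linearised constraint: for every additive `Q` on the fine fields with `Q ∘ G = 0` (print:
  *«Q𝔊 = 0»*, p. 294; at the carrier `Q` = the linearisation of the family's k-fold (0.4) descent, pillar C_k) the solution has `Q A₁ = 0`.
* §5 **`existsUnique_smallSolution158_T3`**, **`size115_solution158_le_T3`** — §2–§3 at `P := F.P K`, `c := L^{K−n}`, directions `Fin 3`,
  for every member `F` of the T³ family and all heights `n, K` (uniform: the file introduces no constant of its own).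
HONEST SCOPE.  (i) Nothing of [Balaban1984PropagatorsI/II] (the bound `B₀` of `G̃`), of Prop. 4 (`C₄`, `a₃`, analyticity of `(δ/δA′)V`),
of Prop. 3 / the chart (47) (which defines `V` through `D`) or of Sect. F's (152)/(160) (the size of `HB`) is proved here: they are the
displayed hypotheses, to be discharged by pillars F3 / C_k / F1–F5 of the census (CENSUS-19200-V2-g4); (ii) `G̃` of (143)/(158) is
`GP₀* − …` of (131), NOT `Δ_a⁻¹` itself — which operator F3 feeds is the composition's choice; (iii) reality of the solution for real data
and analytic dependence on `𝔄` are available abstractly (`B11Prop6Scheme.solution_mem_of_invariant`, `solution_analytic`) and not re-read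
here; (iv) ONE level (the carrier's pure small-field problem); (v) NOT a claim about the mass gap.

References: T. Bałaban, CMP **102** (1985) 277–309 [Balaban1985Variational] (115) p.294, Prop. 6 p.295, (143) p.300, (158) p.302, (165) p.304;
CMP **96** (1984) 223–250 [Balaban1984PropagatorsII] (2.47)–(2.51) p.231.
-/

set_option autoImplicit false

noncomputable section

open Metric Set

namespace Summit.QuantumFields.YangMills.Theorems.FlatSmallSolution158

open Literature.MathematicalPhysics.QuantumFieldTheory.Balaban1983to89
open Literature.MathematicalPhysics.QuantumFieldTheory.Balaban1983to89.B11Eq115Space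
open Literature.MathematicalPhysics.QuantumFieldTheory.Balaban1983to89.B11Prop6Scheme (eq158_solution)
open Literature.MathematicalPhysics.QuantumFieldTheory.Balaban1983to89.B13Contraction113 (QuadAnalytic)

/-! ## §1 The forward difference as a linear map (the `∇` of the jet norm (115) at background 1) -/

section Generic

variable {P : Params} {V : Type*} [NormedAddCommGroup V] [NormedSpace ℂ V]

/-- The forward difference of a bond field, `(b, ν) ↦ A(⟨b₋ + e_ν, μ(b)⟩) − A(b)` (the numerator of `∇^η_ν A_μ` at background `1`), IS a
ℂ-linear map `(PBond P 0 → V) →ₗ[ℂ] (PBond P 0 × Fin d → V)` — packaged as an existence statement (the file declares no definition).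
[cite: Balaban1985Variational, (115) p.294] -/
theorem exists_diffLin (P : Params) (V : Type*) [AddCommGroup V] [Module ℂ V] :
    ∃ D : (PBond P 0 → V) →ₗ[ℂ] (PBond P 0 × Fin P.d → V),
      ∀ (A : PBond P 0 → V) (p : PBond P 0 × Fin P.d), D A p = A ⟨p.1.src.shift p.2, p.1.dir⟩ - A p.1 :=
  ⟨{ toFun := fun A p => A ⟨p.1.src.shift p.2, p.1.dir⟩ - A p.1
     map_add' := fun A B => by funext p; simp only [Pi.add_apply]; abel
     map_smul' := fun z A => by funext p; simp only [Pi.smul_apply, RingHom.id_apply, smul_sub] },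
    fun _ _ => rfl⟩

/-! ## §2 Proposition 6 for Eq. (158) in the concrete sup norms (115), every `Params`, every weight `c > 0` -/

/-- **[Balaban1985Variational] PROPOSITION 6 FOR EQ. (158), AT THE LATTICE `PBond P 0` IN THE SUP NORMS (115)** (weight `c > 0` on the
difference quotient; print `c = (L^jη)⁻¹·η⁻¹·η = η⁻¹` at one level).  Data: a ℂ-linear `G` (print's flat `G̃`) with the sup → (115) bound
`B₀` in the pointwise letters of pillar F3; `W = (δ/δA′)V` with Proposition 4's (98) read pointwise on the (115)-ball of radius `a₃` and
holomorphic there; a configuration `𝔄` (print: `HB`) of (115)-size `< a ≤ ε₄`; Prop. 6's threshold unfolded: `4ε₄ ≤ a₃`, `16B₀C₄ε₄ ≤ 1`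
(print p. 302: *«we assume that 40dL²B₁Mε₀ ≤ a₄»*).  Conclusion: EXACTLY ONE `A₁` with `‖A₁(b)‖ ≤ ε₄`, `c·‖A₁(⟨s+e_ν,μ⟩) − A₁(⟨s,μ⟩)‖ ≤ ε₄`
everywhere and `A₁ + G(W(A₁ + 𝔄)) = 0` — *«A₁ + G̃((δ/δA′)V)(A₁ + HB) = 0. (158)»*.  Proof: the tree's abstract Prop. 6 `B11Prop6Scheme.eq158_solution`
at `𝒴 :=` lit-balaban's jet space `B11Eq115Space.JetSup 1 c ∇` over `ι := PBond P 0` (complete: finite lattice, finite-dimensional fibre) and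
`𝒵 :=` the sup space `NegSup 1`. [cite: Balaban1985Variational, Prop. 6 p.295, (158) p.302] -/
theorem existsUnique_smallSolution158 [FiniteDimensional ℂ V] {c : ℝ} (hc : 0 < c)
    (G : (PBond P 0 → V) →ₗ[ℂ] (PBond P 0 → V)) (W : (PBond P 0 → V) → (PBond P 0 → V))
    {B₀ C₄ a₃ a ε₄ : ℝ} (hB₀ : 0 ≤ B₀) (hC₄ : 0 ≤ C₄)
    (hG : ∀ (f : PBond P 0 → V) (β : ℝ), (∀ b, ‖f b‖ ≤ β) →
      (∀ b, ‖G f b‖ ≤ B₀ * β) ∧ ∀ (s : Site P 0) (μ ν : Fin P.d), c * ‖G f ⟨s.shift ν, μ⟩ - G f ⟨s, μ⟩‖ ≤ B₀ * β)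
    (hWq : ∀ (Y : PBond P 0 → V) (r : ℝ), r < a₃ → (∀ b, ‖Y b‖ ≤ r) →
      (∀ (s : Site P 0) (μ ν : Fin P.d), c * ‖Y ⟨s.shift ν, μ⟩ - Y ⟨s, μ⟩‖ ≤ r) → ∀ b, ‖W Y b‖ ≤ C₄ * r ^ 2)
    (hWd : DifferentiableOn ℂ W {Y : PBond P 0 → V | (∀ b, ‖Y b‖ < a₃) ∧
      ∀ (s : Site P 0) (μ ν : Fin P.d), c * ‖Y ⟨s.shift ν, μ⟩ - Y ⟨s, μ⟩‖ < a₃})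
    (𝔄 : PBond P 0 → V) (h𝔄 : ∀ b, ‖𝔄 b‖ < a)
    (h𝔄' : ∀ (s : Site P 0) (μ ν : Fin P.d), c * ‖𝔄 ⟨s.shift ν, μ⟩ - 𝔄 ⟨s, μ⟩‖ < a)
    (ha : a ≤ ε₄) (hε₄ : 0 ≤ ε₄) (h2 : 4 * ε₄ ≤ a₃) (h3 : 16 * B₀ * C₄ * ε₄ ≤ 1) :
    ∃! A₁ : PBond P 0 → V, ((∀ b, ‖A₁ b‖ ≤ ε₄) ∧
      ∀ (s : Site P 0) (μ ν : Fin P.d), c * ‖A₁ ⟨s.shift ν, μ⟩ - A₁ ⟨s, μ⟩‖ ≤ ε₄) ∧ A₁ + G (W (A₁ + 𝔄)) = 0 := by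
  classical
  obtain ⟨D, hD⟩ := exists_diffLin P V
  -- positivity of the weights, as instances
  haveI hw₀ : Fact (∀ i : PBond P 0, 0 < (fun _ : PBond P 0 => (1 : ℝ)) i) := ⟨fun _ => one_pos⟩
  haveI hw₁ : Fact (∀ k : PBond P 0 × Fin P.d, 0 < (fun _ : PBond P 0 × Fin P.d => c) k) := ⟨fun _ => hc⟩
  -- the carriers: 𝒴 = (115), 𝒵 = sup
  let w₀ : PBond P 0 → ℝ := fun _ => 1
  let w₁ : PBond P 0 × Fin P.d → ℝ := fun _ => c
  let eY := JetSup.equiv (𝕜 := ℂ) (V := V) w₀ w₁ D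
  let eZ := NegSup.equiv w₀ V
  -- 0 < a (the index is nonempty)
  have ha0 : 0 < a := (norm_nonneg _).trans_lt (h𝔄 ⟨default, ⟨0, P.hd⟩⟩)
  -- pointwise reading of the two norms
  have hYle : ∀ (X : JetSup w₀ w₁ D) (r : ℝ), 0 ≤ r →
      (‖X‖ ≤ r ↔ (∀ b, ‖eY X b‖ ≤ r) ∧
        ∀ (s : Site P 0) (μ ν : Fin P.d), c * ‖eY X ⟨s.shift ν, μ⟩ - eY X ⟨s, μ⟩‖ ≤ r) := by
    intro X r hr
    rw [JetSup.norm_le_iff_pointwise hr]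
    refine and_congr (forall_congr' fun b => ?_) ⟨fun h s μ ν => ?_, fun h k => ?_⟩
    · show w₀ b * ‖eY X b‖ ≤ r ↔ ‖eY X b‖ ≤ r
      rw [show w₀ b = 1 from rfl, one_mul]
    · have := h (⟨s, μ⟩, ν); rwa [hD] at this
    · obtain ⟨b, ν⟩ := k; rw [hD]; exact h b.src b.dir ν
  have hYlt : ∀ (X : JetSup w₀ w₁ D) (r : ℝ), 0 < r →
      (‖X‖ < r ↔ (∀ b, ‖eY X b‖ < r) ∧
        ∀ (s : Site P 0) (μ ν : Fin P.d), c * ‖eY X ⟨s.shift ν, μ⟩ - eY X ⟨s, μ⟩‖ < r) := by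
    intro X r hr
    rw [JetSup.norm_lt_iff_pointwise hr]
    refine and_congr (forall_congr' fun b => ?_) ⟨fun h s μ ν => ?_, fun h k => ?_⟩
    · show w₀ b * ‖eY X b‖ < r ↔ ‖eY X b‖ < r
      rw [show w₀ b = 1 from rfl, one_mul]
    · have := h (⟨s, μ⟩, ν); rwa [hD] at this
    · obtain ⟨b, ν⟩ := k; rw [hD]; exact h b.src b.dir ν
  have hZle : ∀ (f : NegSup w₀ V) (r : ℝ), 0 ≤ r → (‖f‖ ≤ r ↔ ∀ b, ‖eZ f b‖ ≤ r) := by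
    intro f r hr
    rw [NegSup.norm_le_iff hr]
    refine forall_congr' fun b => ?_
    show w₀ b * ‖eZ f b‖ ≤ r ↔ ‖eZ f b‖ ≤ r
    rw [show w₀ b = 1 from rfl, one_mul]
  have hZpt : ∀ (f : NegSup w₀ V) (b : PBond P 0), ‖eZ f b‖ ≤ ‖f‖ := fun f b =>
    ((hZle f ‖f‖ (norm_nonneg _)).1 le_rfl) b
  -- the operator 𝒢 : 𝒵 →L[ℂ] 𝒴 and its bound
  let 𝒢ₗ : NegSup w₀ V →ₗ[ℂ] JetSup w₀ w₁ D :=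
    { toFun := fun f => eY.symm (G (eZ f))
      map_add' := fun f g => by
        apply eY.injective; simp only [Equiv.apply_symm_apply, eY, eZ, NegSup.equiv_add, map_add, JetSup.equiv_add]
      map_smul' := fun z f => by
        apply eY.injective
        simp only [Equiv.apply_symm_apply, eY, eZ, NegSup.equiv_smul, map_smul, JetSup.equiv_smul, RingHom.id_apply] }
  let 𝒢 : NegSup w₀ V →L[ℂ] JetSup w₀ w₁ D := LinearMap.toContinuousLinearMap 𝒢ₗ
  have h𝒢apply : ∀ f, eY (𝒢 f) = G (eZ f) := fun f => rfl
  have h𝒢 : ∀ f, ‖𝒢 f‖ ≤ B₀ * ‖f‖ := by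
    intro f
    have hb := hG (eZ f) ‖f‖ (hZpt f)
    rw [hYle _ _ (mul_nonneg hB₀ (norm_nonneg _)), h𝒢apply]
    exact hb
  -- the map W : 𝒴 → 𝒵 and Proposition 4's hypothesis structure
  let 𝒲 : JetSup w₀ w₁ D → NegSup w₀ V := fun Y => eZ.symm (W (eY Y))
  have h𝒲apply : ∀ Y, eZ (𝒲 Y) = W (eY Y) := fun Y => rfl
  have h𝒲 : QuadAnalytic 𝒲 C₄ a₃ := by
    refine ⟨fun Y hY => ?_, fun Pt Q => ?_⟩
    · -- (98): with r := ‖Y‖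
      have hpt := (hYle Y ‖Y‖ (norm_nonneg _)).1 le_rfl
      have hb := hWq (eY Y) ‖Y‖ hY hpt.1 hpt.2
      rw [hZle _ _ (mul_nonneg hC₄ (sq_nonneg _)), h𝒲apply]
      exact hb
    · -- holomorphy along complex lines, from Fréchet holomorphy on the (115)-ball
      have ha₃ : ∀ ζ : ℂ, ‖Pt + ζ • Q‖ < a₃ → 0 < a₃ := fun ζ h => (norm_nonneg _).trans_lt h
      have hline : Differentiable ℂ (fun ζ : ℂ => eY Pt + ζ • eY Q) :=
        (differentiable_const _).add (differentiable_id.smul_const _)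
      have hinto : MapsTo (fun ζ : ℂ => eY Pt + ζ • eY Q) {ζ : ℂ | ‖Pt + ζ • Q‖ < a₃}
          {Y : PBond P 0 → V | (∀ b, ‖Y b‖ < a₃) ∧
            ∀ (s : Site P 0) (μ ν : Fin P.d), c * ‖Y ⟨s.shift ν, μ⟩ - Y ⟨s, μ⟩‖ < a₃} := by
        intro ζ hζ
        have h := (hYlt (Pt + ζ • Q) a₃ (ha₃ ζ hζ)).1 hζ
        exact h
      have hcomp : DifferentiableOn ℂ (fun ζ : ℂ => W (eY Pt + ζ • eY Q)) {ζ : ℂ | ‖Pt + ζ • Q‖ < a₃} :=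
        hWd.comp hline.differentiableOn hinto
      -- compose with the continuous linear identification (ι → V) ≃L 𝒵
      have hcle : DifferentiableOn ℂ
          (fun ζ : ℂ => (NegSup.continuousLinearEquiv ℂ w₀ (V := V)).symm (W (eY Pt + ζ • eY Q)))
          {ζ : ℂ | ‖Pt + ζ • Q‖ < a₃} :=
        (NegSup.continuousLinearEquiv ℂ w₀ (V := V)).symm.differentiable.comp_differentiableOn hcomp
      exact hcle
  -- the datum 𝔄 read in 𝒴 and its size
  have h𝔄Y : ‖eY.symm 𝔄‖ < a := by
    rw [hYlt _ _ ha0]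
    exact ⟨h𝔄, h𝔄'⟩
  -- Proposition 6 for (158), abstractly
  have hmain := eq158_solution (𝒢 := 𝒢) (W := 𝒲) h𝒢 h𝒲 hB₀ hC₄ h𝔄Y ha hε₄ h2 h3
  -- read back on the lattice
  have hcomp : ∀ X : JetSup w₀ w₁ D, eY (-𝒢 (𝒲 (X + eY.symm 𝔄))) = -(G (W (eY X + 𝔄))) := fun X => rfl
  have hfix : ∀ X : JetSup w₀ w₁ D, (-𝒢 (𝒲 (X + eY.symm 𝔄)) = X ↔ eY X + G (W (eY X + 𝔄)) = 0) := by
    intro X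
    constructor
    · intro h
      have e1 : eY X = -(G (W (eY X + 𝔄))) := ((congrArg eY h).symm).trans (hcomp X)
      exact eq_neg_iff_add_eq_zero.1 e1
    · intro h
      apply eY.injective
      rw [hcomp X]
      exact (eq_neg_of_add_eq_zero_left h).symm
  obtain ⟨X, ⟨hXn, hXfix⟩, huniq⟩ := hmain
  refine ⟨eY X, ⟨(hYle X ε₄ hε₄).1 hXn, (hfix X).1 hXfix⟩, fun A₁ hA₁ => ?_⟩
  have h1 : ‖eY.symm A₁‖ ≤ ε₄ := (hYle _ ε₄ hε₄).2 hA₁.1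
  have h2' : -𝒢 (𝒲 (eY.symm A₁ + eY.symm 𝔄)) = eY.symm A₁ := (hfix _).2 hA₁.2
  have := huniq (eY.symm A₁) ⟨h1, h2'⟩
  rw [← this]
  rfl

/-- **The unique small solution of (158) obeys `‖A₁‖₍₁₁₅₎ ≤ B₀C₄(ε₄ + a)²`** (the nested reading of Prop. 6's *«This solution satisfies the
bounds (115) with ε₄ = …»* for (158): the fixed point `A₁ = −G(W(A₁ + 𝔄))` has `‖A₁ + 𝔄‖₍₁₁₅₎ < ε₄ + a ≤ a₃/2` and (98), (117) apply) — same data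
as `existsUnique_smallSolution158`, conclusion: there is an `A₁` of (115)-size `≤ ε₄` solving (158) AND of (115)-size `≤ B₀C₄(ε₄ + a)²`, and every
solution of size `≤ ε₄` equals it. [cite: Balaban1985Variational, Prop. 6 p.295, (158) p.302, (165) p.304] -/
theorem exists_smallSolution158_bound [FiniteDimensional ℂ V] {c : ℝ} (hc : 0 < c)
    (G : (PBond P 0 → V) →ₗ[ℂ] (PBond P 0 → V)) (W : (PBond P 0 → V) → (PBond P 0 → V))
    {B₀ C₄ a₃ a ε₄ : ℝ} (hB₀ : 0 ≤ B₀) (hC₄ : 0 ≤ C₄)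
    (hG : ∀ (f : PBond P 0 → V) (β : ℝ), (∀ b, ‖f b‖ ≤ β) →
      (∀ b, ‖G f b‖ ≤ B₀ * β) ∧ ∀ (s : Site P 0) (μ ν : Fin P.d), c * ‖G f ⟨s.shift ν, μ⟩ - G f ⟨s, μ⟩‖ ≤ B₀ * β)
    (hWq : ∀ (Y : PBond P 0 → V) (r : ℝ), r < a₃ → (∀ b, ‖Y b‖ ≤ r) →
      (∀ (s : Site P 0) (μ ν : Fin P.d), c * ‖Y ⟨s.shift ν, μ⟩ - Y ⟨s, μ⟩‖ ≤ r) → ∀ b, ‖W Y b‖ ≤ C₄ * r ^ 2)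
    (hWd : DifferentiableOn ℂ W {Y : PBond P 0 → V | (∀ b, ‖Y b‖ < a₃) ∧
      ∀ (s : Site P 0) (μ ν : Fin P.d), c * ‖Y ⟨s.shift ν, μ⟩ - Y ⟨s, μ⟩‖ < a₃})
    (𝔄 : PBond P 0 → V) (h𝔄 : ∀ b, ‖𝔄 b‖ < a)
    (h𝔄' : ∀ (s : Site P 0) (μ ν : Fin P.d), c * ‖𝔄 ⟨s.shift ν, μ⟩ - 𝔄 ⟨s, μ⟩‖ < a)
    (ha : a ≤ ε₄) (hε₄ : 0 ≤ ε₄) (h2 : 4 * ε₄ ≤ a₃) (h3 : 16 * B₀ * C₄ * ε₄ ≤ 1) :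
    ∃ A₁ : PBond P 0 → V,
      ((∀ b, ‖A₁ b‖ ≤ ε₄) ∧ ∀ (s : Site P 0) (μ ν : Fin P.d), c * ‖A₁ ⟨s.shift ν, μ⟩ - A₁ ⟨s, μ⟩‖ ≤ ε₄) ∧
      A₁ + G (W (A₁ + 𝔄)) = 0 ∧
      ((∀ b, ‖A₁ b‖ ≤ B₀ * C₄ * (ε₄ + a) ^ 2) ∧
        ∀ (s : Site P 0) (μ ν : Fin P.d), c * ‖A₁ ⟨s.shift ν, μ⟩ - A₁ ⟨s, μ⟩‖ ≤ B₀ * C₄ * (ε₄ + a) ^ 2) ∧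
      ∀ A₁' : PBond P 0 → V, ((∀ b, ‖A₁' b‖ ≤ ε₄) ∧
        ∀ (s : Site P 0) (μ ν : Fin P.d), c * ‖A₁' ⟨s.shift ν, μ⟩ - A₁' ⟨s, μ⟩‖ ≤ ε₄) → A₁' + G (W (A₁' + 𝔄)) = 0 → A₁' = A₁ := by
  obtain ⟨A₁, ⟨hsize, hsol⟩, huniq⟩ :=
    existsUnique_smallSolution158 hc G W hB₀ hC₄ hG hWq hWd 𝔄 h𝔄 h𝔄' ha hε₄ h2 h3
  refine ⟨A₁, hsize, hsol, ?_, fun A₁' h₁ h₂ => huniq A₁' ⟨h₁, h₂⟩⟩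
  -- ‖A₁ + 𝔄‖ ≤ ε₄ + a < a₃ pointwise, then §3's mechanism
  have hρ : ε₄ + a < a₃ := by
    have ha0 : 0 < a := (norm_nonneg _).trans_lt (h𝔄 ⟨default, ⟨0, P.hd⟩⟩)
    linarith
  have hc0 : 0 ≤ c := hc.le
  have hp1 : ∀ b, ‖(A₁ + 𝔄) b‖ ≤ ε₄ + a := fun b =>
    (norm_add_le _ _).trans (add_le_add (hsize.1 b) (h𝔄 b).le)
  have hp2 : ∀ (s : Site P 0) (μ ν : Fin P.d), c * ‖(A₁ + 𝔄) ⟨s.shift ν, μ⟩ - (A₁ + 𝔄) ⟨s, μ⟩‖ ≤ ε₄ + a := by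
    intro s μ ν
    have e : (A₁ + 𝔄) ⟨s.shift ν, μ⟩ - (A₁ + 𝔄) ⟨s, μ⟩ = (A₁ ⟨s.shift ν, μ⟩ - A₁ ⟨s, μ⟩) + (𝔄 ⟨s.shift ν, μ⟩ - 𝔄 ⟨s, μ⟩) := by
      simp only [Pi.add_apply]; abel
    rw [e]
    calc c * ‖(A₁ ⟨s.shift ν, μ⟩ - A₁ ⟨s, μ⟩) + (𝔄 ⟨s.shift ν, μ⟩ - 𝔄 ⟨s, μ⟩)‖
        ≤ c * (‖A₁ ⟨s.shift ν, μ⟩ - A₁ ⟨s, μ⟩‖ + ‖𝔄 ⟨s.shift ν, μ⟩ - 𝔄 ⟨s, μ⟩‖) :=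
          mul_le_mul_of_nonneg_left (norm_add_le _ _) hc0
      _ = c * ‖A₁ ⟨s.shift ν, μ⟩ - A₁ ⟨s, μ⟩‖ + c * ‖𝔄 ⟨s.shift ν, μ⟩ - 𝔄 ⟨s, μ⟩‖ := mul_add _ _ _
      _ ≤ ε₄ + a := add_le_add (hsize.2 s μ ν) (h𝔄' s μ ν).le
  have hW := hWq (A₁ + 𝔄) (ε₄ + a) hρ hp1 hp2
  have hGW := hG (W (A₁ + 𝔄)) (C₄ * (ε₄ + a) ^ 2) hW
  have hA : A₁ = -(G (W (A₁ + 𝔄))) := eq_neg_of_add_eq_zero_left hsol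
  refine ⟨fun b => ?_, fun s μ ν => ?_⟩
  · rw [hA, Pi.neg_apply, norm_neg, mul_assoc]; exact hGW.1 b
  · rw [hA, Pi.neg_apply, Pi.neg_apply, ← neg_sub, norm_neg, ← norm_neg, neg_sub, neg_sub_neg, mul_assoc, ← norm_neg, neg_sub]
    exact hGW.2 s μ ν

/-! ## §3 The a-priori bound of ANY solution of (158): the middle term `B₀C₄(36dL²B₁Mε₀)²` of (165) -/

omit [NormedSpace ℂ V] in
/-- **`‖A₁‖₍₁₁₅₎ ≤ B₀C₄ρ²` FOR EVERY SOLUTION OF (158) WITH `‖A₁ + 𝔄‖₍₁₁₅₎ ≤ ρ < a₃`** — the entry of (165) p. 304 (*«the equality (159) and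
Eq. (158) imply … + B₀C₄(36dL²B₁Mε₀)² + …»*: `A₁ = −G̃((δ/δA′)V)(A₁ + HB)`, the sup → (115) bound `B₀` of `G̃` and (98) with `‖A₁ + HB‖₍₁₁₅₎ ≤
36dL²B₁Mε₀ =: ρ`).  Pointwise letters; any additive `G` (here ℂ-linear on `V`-valued fields, `V` any complex normed space); no smallness and no
uniqueness needed. [cite: Balaban1985Variational, (165) p.304, (158) p.302, (98) p.293] -/
theorem size115_solution158_le [NormedSpace ℂ V] {c : ℝ}
    (G : (PBond P 0 → V) →ₗ[ℂ] (PBond P 0 → V)) (W : (PBond P 0 → V) → (PBond P 0 → V)) {B₀ C₄ a₃ ρ : ℝ}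
    (hG : ∀ (f : PBond P 0 → V) (β : ℝ), (∀ b, ‖f b‖ ≤ β) →
      (∀ b, ‖G f b‖ ≤ B₀ * β) ∧ ∀ (s : Site P 0) (μ ν : Fin P.d), c * ‖G f ⟨s.shift ν, μ⟩ - G f ⟨s, μ⟩‖ ≤ B₀ * β)
    (hWq : ∀ (Y : PBond P 0 → V) (r : ℝ), r < a₃ → (∀ b, ‖Y b‖ ≤ r) →
      (∀ (s : Site P 0) (μ ν : Fin P.d), c * ‖Y ⟨s.shift ν, μ⟩ - Y ⟨s, μ⟩‖ ≤ r) → ∀ b, ‖W Y b‖ ≤ C₄ * r ^ 2)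
    {A₁ 𝔄 : PBond P 0 → V} (hsol : A₁ + G (W (A₁ + 𝔄)) = 0) (hρ : ρ < a₃)
    (h1 : ∀ b, ‖(A₁ + 𝔄) b‖ ≤ ρ)
    (h2 : ∀ (s : Site P 0) (μ ν : Fin P.d), c * ‖(A₁ + 𝔄) ⟨s.shift ν, μ⟩ - (A₁ + 𝔄) ⟨s, μ⟩‖ ≤ ρ) :
    (∀ b, ‖A₁ b‖ ≤ B₀ * C₄ * ρ ^ 2) ∧
      ∀ (s : Site P 0) (μ ν : Fin P.d), c * ‖A₁ ⟨s.shift ν, μ⟩ - A₁ ⟨s, μ⟩‖ ≤ B₀ * C₄ * ρ ^ 2 := by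
  have hW := hWq (A₁ + 𝔄) ρ hρ h1 h2
  have hGW := hG (W (A₁ + 𝔄)) (C₄ * ρ ^ 2) hW
  have hA : A₁ = -(G (W (A₁ + 𝔄))) := eq_neg_of_add_eq_zero_left hsol
  refine ⟨fun b => ?_, fun s μ ν => ?_⟩
  · rw [hA, Pi.neg_apply, norm_neg, mul_assoc]; exact hGW.1 b
  · rw [hA, Pi.neg_apply, Pi.neg_apply, neg_sub_neg, mul_assoc, ← norm_neg, neg_sub]
    exact hGW.2 s μ ν

/-! ## §4 The linearised constraint: `Q ∘ G̃ = 0 ⇒ QA₁ = 0` -/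

omit [NormedSpace ℂ V] in
/-- **The solution satisfies the TRUE linearised constraint** — p. 294: *«the operator 𝔊 … satisfying the equalities Q𝔊 = 0, RD*𝔊 = 0. Thus any
solution of (110) satisfies automatically Eq. (108), (109)»*; at background `1` for (158): every additive `Q` on the fine fields with `Q ∘ G̃ = 0`
(at the carrier: the linearisation of the family's k-fold (0.4) descent — pillar C_k — or the residual Landau gauge `R∂*`) annihilates every
solution `A₁ = −G̃(W(A₁ + 𝔄))`. [cite: Balaban1985Variational, (108)-(111) p.294, (158) p.302] -/
theorem solution158_mem_ker [NormedSpace ℂ V] {X : Type*} [AddCommGroup X] (Q : (PBond P 0 → V) →+ X)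
    (G : (PBond P 0 → V) →ₗ[ℂ] (PBond P 0 → V)) (W : (PBond P 0 → V) → (PBond P 0 → V)) (hQ : ∀ f, Q (G f) = 0)
    {A₁ 𝔄 : PBond P 0 → V} (hsol : A₁ + G (W (A₁ + 𝔄)) = 0) : Q A₁ = 0 := by
  rw [eq_neg_of_add_eq_zero_left hsol, map_neg, hQ, neg_zero]

end Generic

/-! ## §5 At the d = 3 carrier of `T3Thm1Carrier.varProblem3 F n K`: fine torus `PBond (F.P K) 0`, weight `c = L^{K−n} = η⁻¹` -/

section T3

open T3ContinuumYM3Torus (T3Family)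

variable {V : Type*} [NormedAddCommGroup V] [NormedSpace ℂ V] [FiniteDimensional ℂ V]

/-- **PILLAR F4 AT THE d = 3 CARRIER — [Balaban1985Variational] PROP. 6 FOR EQ. (158) ON THE FINE TORUS OF RUN `K` OVER THE COMPARISON HEIGHT `n`**
(the configurations of `T3Thm1Carrier.famX L ⟨(F, n, K), …⟩` are `PBond (F.P K) 0 → SU(2)`; the fields `A₁`, `HB`, `(δ/δA′)V` live on the same bonds
with values in the complexified Lie algebra `V`; `η⁻¹ = L^{K−n}`): for EVERY member `F` of the T³ family and ALL heights `n`, `K` — given `G̃` with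
the sup → (115) bound `B₀` (letters of `FlatPropagatorSup/Grad`, `FlatMinimizerH`: `|G̃f| ≤ B₀β`, `L^{K−n}|(G̃f)(⟨s+e_ν,μ⟩) − (G̃f)(⟨s,μ⟩)| ≤ B₀β` for
`|f| ≤ β`), `W = (δ/δA′)V` with Proposition 4's (98) and holomorphy on the (115)-ball of radius `a₃`, `𝔄 = HB` of (115)-size `< a ≤ ε₄`, and
`4ε₄ ≤ a₃`, `16B₀C₄ε₄ ≤ 1` (print: *«we assume that 40dL²B₁Mε₀ ≤ a₄»*): EXACTLY ONE `A₁` of (115)-size `≤ ε₄` solves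
*«A₁ + G̃((δ/δA′)V)(A₁ + HB) = 0. (158)»*.  Uniform in `F` (`L`, `m`), `n`, `K`: no constant is introduced. [cite: Balaban1985Variational, Prop. 6 p.295, (158) p.302] -/
theorem existsUnique_smallSolution158_T3 (F : T3Family) (n K : ℕ)
    (G : (PBond (F.P K) 0 → V) →ₗ[ℂ] (PBond (F.P K) 0 → V)) (W : (PBond (F.P K) 0 → V) → (PBond (F.P K) 0 → V))
    {B₀ C₄ a₃ a ε₄ : ℝ} (hB₀ : 0 ≤ B₀) (hC₄ : 0 ≤ C₄)
    (hG : ∀ (f : PBond (F.P K) 0 → V) (β : ℝ), (∀ b, ‖f b‖ ≤ β) →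
      (∀ b, ‖G f b‖ ≤ B₀ * β) ∧
        ∀ (s : Site (F.P K) 0) (μ ν : Fin 3), (F.L : ℝ) ^ (K - n) * ‖G f ⟨s.shift ν, μ⟩ - G f ⟨s, μ⟩‖ ≤ B₀ * β)
    (hWq : ∀ (Y : PBond (F.P K) 0 → V) (r : ℝ), r < a₃ → (∀ b, ‖Y b‖ ≤ r) →
      (∀ (s : Site (F.P K) 0) (μ ν : Fin 3), (F.L : ℝ) ^ (K - n) * ‖Y ⟨s.shift ν, μ⟩ - Y ⟨s, μ⟩‖ ≤ r) →
        ∀ b, ‖W Y b‖ ≤ C₄ * r ^ 2)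
    (hWd : DifferentiableOn ℂ W {Y : PBond (F.P K) 0 → V | (∀ b, ‖Y b‖ < a₃) ∧
      ∀ (s : Site (F.P K) 0) (μ ν : Fin 3), (F.L : ℝ) ^ (K - n) * ‖Y ⟨s.shift ν, μ⟩ - Y ⟨s, μ⟩‖ < a₃})
    (𝔄 : PBond (F.P K) 0 → V) (h𝔄 : ∀ b, ‖𝔄 b‖ < a)
    (h𝔄' : ∀ (s : Site (F.P K) 0) (μ ν : Fin 3), (F.L : ℝ) ^ (K - n) * ‖𝔄 ⟨s.shift ν, μ⟩ - 𝔄 ⟨s, μ⟩‖ < a)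
    (ha : a ≤ ε₄) (hε₄ : 0 ≤ ε₄) (h2 : 4 * ε₄ ≤ a₃) (h3 : 16 * B₀ * C₄ * ε₄ ≤ 1) :
    ∃! A₁ : PBond (F.P K) 0 → V, ((∀ b, ‖A₁ b‖ ≤ ε₄) ∧
      ∀ (s : Site (F.P K) 0) (μ ν : Fin 3), (F.L : ℝ) ^ (K - n) * ‖A₁ ⟨s.shift ν, μ⟩ - A₁ ⟨s, μ⟩‖ ≤ ε₄) ∧
        A₁ + G (W (A₁ + 𝔄)) = 0 := by
  have hL : (0 : ℝ) < F.L := by exact_mod_cast lt_trans zero_lt_one F.hL.2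
  exact existsUnique_smallSolution158 (P := F.P K) (pow_pos hL _) G W hB₀ hC₄ hG hWq hWd 𝔄 h𝔄 h𝔄' ha hε₄ h2 h3

omit [FiniteDimensional ℂ V] in
/-- **THE (165) ENTRY AT THE d = 3 CARRIER**: any solution of (158) on the fine torus `PBond (F.P K) 0` with `‖A₁ + HB‖₍₁₁₅₎ ≤ ρ < a₃`
(print: `ρ = 36dL²B₁Mε₀`, from (152)) satisfies `|A₁| ≤ B₀C₄ρ²` and `L^{K−n}·|A₁(⟨s+e_ν,μ⟩) − A₁(⟨s,μ⟩)| ≤ B₀C₄ρ²` — *«+ B₀C₄(36dL²B₁Mε₀)²»* of (165).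
[cite: Balaban1985Variational, (165) p.304, (158) p.302] -/
theorem size115_solution158_le_T3 (F : T3Family) (n K : ℕ)
    (G : (PBond (F.P K) 0 → V) →ₗ[ℂ] (PBond (F.P K) 0 → V)) (W : (PBond (F.P K) 0 → V) → (PBond (F.P K) 0 → V))
    {B₀ C₄ a₃ ρ : ℝ}
    (hG : ∀ (f : PBond (F.P K) 0 → V) (β : ℝ), (∀ b, ‖f b‖ ≤ β) →
      (∀ b, ‖G f b‖ ≤ B₀ * β) ∧
        ∀ (s : Site (F.P K) 0) (μ ν : Fin 3), (F.L : ℝ) ^ (K - n) * ‖G f ⟨s.shift ν, μ⟩ - G f ⟨s, μ⟩‖ ≤ B₀ * β)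
    (hWq : ∀ (Y : PBond (F.P K) 0 → V) (r : ℝ), r < a₃ → (∀ b, ‖Y b‖ ≤ r) →
      (∀ (s : Site (F.P K) 0) (μ ν : Fin 3), (F.L : ℝ) ^ (K - n) * ‖Y ⟨s.shift ν, μ⟩ - Y ⟨s, μ⟩‖ ≤ r) →
        ∀ b, ‖W Y b‖ ≤ C₄ * r ^ 2)
    {A₁ 𝔄 : PBond (F.P K) 0 → V} (hsol : A₁ + G (W (A₁ + 𝔄)) = 0) (hρ : ρ < a₃)
    (h1 : ∀ b, ‖(A₁ + 𝔄) b‖ ≤ ρ)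
    (h2 : ∀ (s : Site (F.P K) 0) (μ ν : Fin 3), (F.L : ℝ) ^ (K - n) * ‖(A₁ + 𝔄) ⟨s.shift ν, μ⟩ - (A₁ + 𝔄) ⟨s, μ⟩‖ ≤ ρ) :
    (∀ b, ‖A₁ b‖ ≤ B₀ * C₄ * ρ ^ 2) ∧
      ∀ (s : Site (F.P K) 0) (μ ν : Fin 3), (F.L : ℝ) ^ (K - n) * ‖A₁ ⟨s.shift ν, μ⟩ - A₁ ⟨s, μ⟩‖ ≤ B₀ * C₄ * ρ ^ 2 :=
  size115_solution158_le (P := F.P K) G W hG hWq hsol hρ h1 h2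

end T3

end Summit.QuantumFields.YangMills.Theorems.FlatSmallSolution158

end
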